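import Mathlib
import Summits.ResolutionOfSingularities.ResolutionOfSingularities.Theorems.WeightedInvariantLocalWeightedDropNCResRegimeDefs
import Summits.ResolutionOfSingularities.ResolutionOfSingularities.Theorems.WeightedInvariantLocalWeightedDropNCResSettingHeadDropCurve
import Summits.ResolutionOfSingularities.ResolutionOfSingularities.Theorems.WeightedInvariantLocalWeightedDropPolyDescentBridgeExits
import Summits.ResolutionOfSingularities.ResolutionOfSingularities.Theorems.WeightedInvariantLocalWeightedDropTOT2BridgeDecorated
import Summits.ResolutionOfSingularities.ResolutionOfSingularities.Theorems.WeightedInvariantLocalWeightedDropTOT2BridgeOldLetter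
import Summits.ResolutionOfSingularities.ResolutionOfSingularities.Theorems.WeightedInvariantLocalWeightedDropTOT2NearOld
import Summits.ResolutionOfSingularities.ResolutionOfSingularities.Theorems.WeightedInvariantLocalWeightedDropNCPolyBridgeExit

/-!
# `WeightedInvariant.LocalWeightedDrop`, TOT2-LINE v1.3 piece (P2), part 1: **THE SAME-HEAD EXITS OF A PRESENTED STATE, READ** — a well-prepared
# label that is not a position means the APEX COLUMN (`HCol`), and the zero label cannot occur at `o ≥ 2`

Crux item stmt-ResolutionOfSingularities-8899 `LocalWeightedDrop` (route `ResolutionOfSingularities/WeightedInvariant`), ENGINE skeleton v33 (candidate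
35b29332b4d99231, res-L1-w43-lead-1 g5), stub `stub_regimePresented`; TOT2-LINE v1.3 §3 (P2) «same head with `HCol` (¬IsPosT exit read through WP)».
[OURS · L1 W4.3 · chain w43 · stub worker res-L1-w43-stub-2 (gen 5), dealt (P2) 15:24/15:29Z; assembly of res-type-083's `WildMonic.exists_linShift_isPos_of_wide`,
the lead prover's `PolyDescent.isPosT_of_wellPrepared_of_isPosT_linShift`, res-L1-w43-stub-1's `apexLine_subst_legal` (…NCResSettingHeadDropCurve) and
res-L1-w43-lead-1's `Decoration.HCol` (…NCResRegimeDefs).  Nothing here is a statement of any manuscript; AI-produced, gate-checked, weaker than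
expert review.  Definition-free.]

SETTING.  A decorated state `δ` PRESENTED by a legal `Θ` (zero constants, invertible linear part, boundary letters straightened):
`(f · ∏_{l∈O} x_l) ∘ Θ = H · (y^d + Σ A_j y^j)`, `H(0) ≠ 0`, with `d = c` (the head did not drop).
* `hcol_monicForm_of_wellPrepared_of_not_isPosT` — (`k` algebraically closed) a WELL-PREPARED label of degree `d` whose monic form has order `≥ d` but
  which is NOT a position has every two invariance vectors of `in_d` dependent (were the form wide, a LINEAR re-centring would make the label a position
  — `exists_linShift_isPos_of_wide` — and well-preparedness forbids that, `isPosT_of_wellPrepared_of_isPosT_linShift`);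
* `isInv_iff_of_unit_mul`, `order_monicForm_of_presentation` — bookkeeping (a unit factor does not change invariance vectors; the presented form has order `c`);
* **`Decoration.hCol_of_presentation_of_not_isPosT`** — hence such a state is in the APEX COLUMN `δ.HCol` (transport of invariance vectors along the
  inverse of `Θ`, `exists_legal_inverse` + `apexLine_subst_legal`);
* `squarefree_subst_of_legal` — a legal coordinate change preserves square-freeness;
* **`Decoration.newtonSet_nonempty_of_presentation`** — at `o ≥ 2` the presented label has NON-EMPTY Newton set (else `f ∘ Θ = unit · y^o`, not
  square-free) — so `¬ InPoly` of a same-head presented label IS `¬ IsPosT`, i.e. `HCol`.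
-/

set_option linter.dupNamespace false -- mandated namespace of this single-conjunct summit

noncomputable section

namespace Summit.ResolutionOfSingularities.ResolutionOfSingularities.Theorems

namespace TameFourTupleDrop

open MvPowerSeries Literature.AlgebraicGeometry.Resolution

variable {k : Type} [Field k] {m : ℕ}

/-! ## A well-prepared non-position of full order is in the apex column -/

/-- **WELL-PREPARED, ORDER `≥ d`, NOT A POSITION ⇒ APEX COLUMN** (`k` algebraically closed, `d ≥ 1`): every two translation-invariance vectors of the
degree-`d` form of `y^d + Σ T_j y^j` are linearly dependent. -/
theorem hcol_monicForm_of_wellPrepared_of_not_isPosT (k : Type) [Field k] [IsAlgClosed k] {d : ℕ} (hd : 0 < d)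
    {T : Fin d → MvPowerSeries (Fin 2) k} (hWP : PolyDescent.WellPrepared d T) (hnpos : ¬ PolyDescent.IsPosT d T)
    (hSo : (d : ℕ∞) ≤ ((X (Fin.last 2) : MvPowerSeries (Fin (2 + 1)) k) ^ d +
      ∑ j : Fin d, rename (Fin.succAboveEmb (Fin.last 2)) (T j) * X (Fin.last 2) ^ (j : ℕ)).order)
    (c₁ c₂ : Fin 3 → k)
    (h₁ : ∀ v : Fin 3 → k, CobordantChart.initEval (fun _ : Fin 3 => 1) (v + c₁) d
      ((X (Fin.last 2) : MvPowerSeries (Fin (2 + 1)) k) ^ d + ∑ j : Fin d, rename (Fin.succAboveEmb (Fin.last 2)) (T j) * X (Fin.last 2) ^ (j : ℕ)) =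
      CobordantChart.initEval (fun _ : Fin 3 => 1) v d
      ((X (Fin.last 2) : MvPowerSeries (Fin (2 + 1)) k) ^ d + ∑ j : Fin d, rename (Fin.succAboveEmb (Fin.last 2)) (T j) * X (Fin.last 2) ^ (j : ℕ)))
    (h₂ : ∀ v : Fin 3 → k, CobordantChart.initEval (fun _ : Fin 3 => 1) (v + c₂) d
      ((X (Fin.last 2) : MvPowerSeries (Fin (2 + 1)) k) ^ d + ∑ j : Fin d, rename (Fin.succAboveEmb (Fin.last 2)) (T j) * X (Fin.last 2) ^ (j : ℕ)) =
      CobordantChart.initEval (fun _ : Fin 3 => 1) v d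
      ((X (Fin.last 2) : MvPowerSeries (Fin (2 + 1)) k) ^ d + ∑ j : Fin d, rename (Fin.succAboveEmb (Fin.last 2)) (T j) * X (Fin.last 2) ^ (j : ℕ))) :
    ∃ α β : k, (α ≠ 0 ∨ β ≠ 0) ∧ α • c₁ + β • c₂ = 0 := by
  by_contra hne
  push Not at hne
  have hind : ∀ α β : k, α • c₁ + β • c₂ = 0 → α = 0 ∧ β = 0 := by
    intro α β h
    by_contra h'
    exact hne α β (by tauto) h
  obtain ⟨μ, hμ⟩ := WildMonic.exists_linShift_isPos_of_wide k hd T hSo c₁ c₂ hind h₁ h₂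
  exact hnpos (PolyDescent.isPosT_of_wellPrepared_of_isPosT_linShift hd hWP μ hμ)

/-- Invariance vectors of `in_d (U · P)` are those of `in_d P` for a unit `U` (`ord P ≥ d`). -/
theorem isInv_iff_of_unit_mul {N : ℕ} (U P : MvPowerSeries (Fin N) k) (hU : constantCoeff U ≠ 0) {d : ℕ} (hP : (d : ℕ∞) ≤ P.order)
    (u : Fin N → k) :
    (∀ v, CobordantChart.initEval (fun _ : Fin N => 1) (v + u) d (U * P) = CobordantChart.initEval (fun _ : Fin N => 1) v d (U * P)) ↔
      (∀ v, CobordantChart.initEval (fun _ : Fin N => 1) (v + u) d P = CobordantChart.initEval (fun _ : Fin N => 1) v d P) := by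
  simp only [TOT2Near.initEval_mul_of_le_order U P hP]
  exact ⟨fun h v => mul_left_cancel₀ hU (h v), fun h v => by rw [h v]⟩

section Presented

variable {b : MvPowerSeries (Fin (2 + 1)) k} {δ : Decoration k 2} {Θ : Fin (2 + 1) → MvPowerSeries (Fin (2 + 1)) k}
  {H : MvPowerSeries (Fin (2 + 1)) k} {d : ℕ} {A : Fin d → MvPowerSeries (Fin 2) k}

/-- The presented monic form has order `c` (a legal change keeps the order; the unit does not count). -/
theorem order_monicForm_of_presentation (hadm : Admissible b δ) (hΘ0 : ∀ i, constantCoeff (Θ i) = 0)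
    (hΘdet : IsUnit (FormalCoordChange.linMat Θ).det) (hH : constantCoeff H ≠ 0)
    (hpres : subst Θ (δ.f * ∏ l ∈ δ.O, X l) = H * NCPoly.monicGerm d A) :
    (NCPoly.monicGerm d A).order = (δ.c : ℕ∞) := by
  have h := NCTransport.order_subst_eq_of_isUnit_det hΘ0 hΘdet (δ.f * ∏ l ∈ δ.O, X l)
  rw [hpres, Decoration.order_totalO hadm, order_mul, WildTerminal.order_eq_zero_of_constantCoeff_ne_zero hH, zero_add] at h
  exact h

/-- **A SAME-HEAD PRESENTED STATE WHOSE LABEL IS WELL-PREPARED BUT NOT A POSITION IS IN THE APEX COLUMN** (`k` algebraically closed):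
the invariance vectors of `in_c (f · ∏_O x_l)` and of `in_d (y^d + Σ A_j y^j)` correspond under the linear part of `Θ` (`apexLine_subst_legal` on the
inverse change), and the latter are pairwise dependent (`hcol_monicForm_of_wellPrepared_of_not_isPosT`). -/
theorem Decoration.hCol_of_presentation_of_not_isPosT [IsAlgClosed k] (hadm : Admissible b δ) (hΘ0 : ∀ i, constantCoeff (Θ i) = 0)
    (hΘdet : IsUnit (FormalCoordChange.linMat Θ).det) (hH : constantCoeff H ≠ 0) (hd : 0 < d)
    (hpres : subst Θ (δ.f * ∏ l ∈ δ.O, X l) = H * NCPoly.monicGerm d A) (hcd : δ.c = d)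
    (hWP : PolyDescent.WellPrepared d A) (hnpos : ¬ PolyDescent.IsPosT d A) : δ.HCol := by
  have hPo : (NCPoly.monicGerm d A).order = (d : ℕ∞) := by rw [order_monicForm_of_presentation hadm hΘ0 hΘdet hH hpres, hcd]
  -- the inverse change
  obtain ⟨Ψ, hΨ0, hΨdet, hleft, -, -⟩ := exists_legal_inverse hΘ0 hΘdet
  have hg : δ.f * ∏ l ∈ δ.O, X l = subst Ψ (H * NCPoly.monicGerm d A) := by rw [← hpres, hleft]
  have hHPo : (H * NCPoly.monicGerm d A).order = (d : ℕ∞) := by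
    rw [order_mul, WildTerminal.order_eq_zero_of_constantCoeff_ne_zero hH, zero_add, hPo]
  -- invariance vectors of `H · P` are those of `P`, pairwise dependent
  have hone : ∀ u₁ u₂ : Fin (2 + 1) → k,
      (∀ v, CobordantChart.initEval (fun _ : Fin (2 + 1) => 1) (v + u₁) d (H * NCPoly.monicGerm d A) =
        CobordantChart.initEval (fun _ : Fin (2 + 1) => 1) v d (H * NCPoly.monicGerm d A)) →
      (∀ v, CobordantChart.initEval (fun _ : Fin (2 + 1) => 1) (v + u₂) d (H * NCPoly.monicGerm d A) =
        CobordantChart.initEval (fun _ : Fin (2 + 1) => 1) v d (H * NCPoly.monicGerm d A)) →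
      ∃ α β : k, (α ≠ 0 ∨ β ≠ 0) ∧ α • u₁ + β • u₂ = 0 := by
    intro u₁ u₂ hu₁ hu₂
    rw [isInv_iff_of_unit_mul H _ hH hPo.symm.le] at hu₁ hu₂
    exact hcol_monicForm_of_wellPrepared_of_not_isPosT k hd hWP hnpos hPo.symm.le u₁ u₂ hu₁ hu₂
  intro v₁ v₂ hv₁ hv₂
  unfold Decoration.IsInv at hv₁ hv₂
  rw [hcd, hg] at hv₁ hv₂
  exact apexLine_subst_legal Ψ hΨ0 hΨdet (H * NCPoly.monicGerm d A) hHPo hone v₁ v₂ hv₁ hv₂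

/-! ## The zero label cannot be presented at `o ≥ 2` -/

/-- A legal coordinate change preserves square-freeness. -/
theorem squarefree_subst_of_legal {n : ℕ} {Φ : Fin n → MvPowerSeries (Fin n) k} (hΦ0 : ∀ i, constantCoeff (Φ i) = 0)
    (hΦdet : IsUnit (FormalCoordChange.linMat Φ).det) {f : MvPowerSeries (Fin n) k} (hf : Squarefree f) : Squarefree (subst Φ f) := by
  obtain ⟨Ψ, hΨ0, -, hleft, -, -⟩ := exists_legal_inverse hΦ0 hΦdet
  have hΨs : HasSubst Ψ := hasSubst_of_constantCoeff_zero hΨ0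
  intro a ha
  obtain ⟨q, hq⟩ := ha
  have h : subst Ψ a * subst Ψ a ∣ f := ⟨subst Ψ q, by
    have := congrArg (subst Ψ) hq
    rw [hleft, ← coe_substAlgHom hΨs, map_mul, map_mul, coe_substAlgHom] at this
    exact this⟩
  have hu := hf _ h
  rw [isUnit_iff_constantCoeff] at hu ⊢
  rwa [constantCoeff_subst_of_constantCoeff_zero _ hΨ0] at hu

/-- **AT `o ≥ 2` A PRESENTED LABEL HAS NON-EMPTY NEWTON SET**: otherwise the presented form is `H · y^d`, the old letters contribute `y^{|O|}`, so
`f ∘ Θ = unit · y^o` with `o ≥ 2` — not square-free, against admissibility (`squarefree_subst_of_legal`). -/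
theorem Decoration.newtonSet_nonempty_of_presentation (hadm : Admissible b δ) (hΘ0 : ∀ i, constantCoeff (Θ i) = 0)
    (hΘdet : IsUnit (FormalCoordChange.linMat Θ).det)
    (hΘE : ∀ l ∈ δ.E, ∃ (l' : Fin (2 + 1)) (u : MvPowerSeries (Fin (2 + 1)) k), constantCoeff u ≠ 0 ∧ Θ l = u * X l')
    (hH : constantCoeff H ≠ 0) (hpres : subst Θ (δ.f * ∏ l ∈ δ.O, X l) = H * NCPoly.monicGerm d A) (hcd : δ.c = d) (ho : 2 ≤ δ.o) :
    (WildMonic.newtonSet A).Nonempty := by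
  classical
  by_contra hne
  have hA : A = fun _ => 0 := PolyDescent.eq_zero_of_newtonSet_not_nonempty hne
  rw [hA] at hpres
  have hpres0 : subst Θ (δ.f * ∏ l ∈ δ.O, X l) = H * (X (Fin.last 2) ^ d +
      ∑ j : Fin d, rename (Fin.succAboveEmb (Fin.last 2)) ((fun _ : Fin d => (0 : MvPowerSeries (Fin 2) k)) j) * X (Fin.last 2) ^ (j : ℕ)) :=
    hpres
  rw [NCPoly.monicGerm_zero] at hpres
  have hperm : IsBPermissible δ Θ (fun _ => 1) := isBPermissible_point ⟨hΘ0, hΘdet, fun _ => le_rfl, ⟨0, Nat.one_pos⟩⟩ hΘE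
  have hΘs : HasSubst Θ := hasSubst_of_constantCoeff_zero hΘ0
  have hprime := MvPowerSeries.prime_X' k (Fin.last 2 : Fin (2 + 1))
  -- the old letters go to units times `y`
  have hstr : ∀ l ∈ δ.O, ∃ u : MvPowerSeries (Fin (2 + 1)) k, constantCoeff u ≠ 0 ∧ Θ l = u * X (Fin.last 2) := fun l hl =>
    exists_apply_eq_unit_mul_X_last_of_presentation hperm hH hpres0 hl
  choose! u hu using hstr
  have hprod : subst Θ (δ.f * ∏ l ∈ δ.O, X l) = subst Θ δ.f * (∏ l ∈ δ.O, u l) * X (Fin.last 2) ^ δ.O.card := by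
    rw [← coe_substAlgHom hΘs, map_mul, map_prod]
    have h : ∀ l ∈ δ.O, substAlgHom hΘs (X l : MvPowerSeries (Fin (2 + 1)) k) = u l * X (Fin.last 2) := fun l hl => by
      rw [coe_substAlgHom, subst_X hΘs]; exact (hu l hl).2
    rw [Finset.prod_congr rfl h, Finset.prod_mul_distrib, Finset.prod_const, coe_substAlgHom, mul_assoc]
  have hU0 : constantCoeff (∏ l ∈ δ.O, u l) ≠ 0 := by
    rw [map_prod]; exact Finset.prod_ne_zero_iff.mpr fun l hl => (hu l hl).1
  -- cancel `y^{|O|}`: `f ∘ Θ · U₀ = H · y^o`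
  have hdc : d = δ.o + δ.O.card := by rw [← hcd, Decoration.c]
  have hkey : subst Θ δ.f * (∏ l ∈ δ.O, u l) * X (Fin.last 2) ^ δ.O.card = H * X (Fin.last 2) ^ δ.o * X (Fin.last 2) ^ δ.O.card := by
    rw [← hprod, hpres, hdc, pow_add, mul_assoc]
  have hyne : (X (Fin.last 2) : MvPowerSeries (Fin (2 + 1)) k) ^ δ.O.card ≠ 0 := pow_ne_zero _ hprime.ne_zero
  have hkey' : subst Θ δ.f * ∏ l ∈ δ.O, u l = H * X (Fin.last 2) ^ δ.o := mul_right_cancel₀ hyne hkey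
  -- `y^2 ∣ f ∘ Θ`
  have hdvd2 : X (Fin.last 2) * X (Fin.last 2) ∣ subst Θ δ.f * ∏ l ∈ δ.O, u l := by
    rw [hkey', ← pow_two]
    exact Dvd.dvd.mul_left (pow_dvd_pow _ ho) _
  have hdvd : X (Fin.last 2) * X (Fin.last 2) ∣ subst Θ δ.f := by
    have hcop : ¬ X (Fin.last 2) ∣ ∏ l ∈ δ.O, u l := not_X_dvd_of_constantCoeff_ne_zero' _ hU0
    rw [← pow_two] at hdvd2 ⊢
    exact (hprime.pow_dvd_of_dvd_mul_right 2 hcop) hdvd2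
  have hsq := squarefree_subst_of_legal hΘ0 hΘdet hadm.2.1
  have hunit := hsq _ hdvd
  rw [isUnit_iff_constantCoeff, constantCoeff_X] at hunit
  exact hunit.ne_zero rfl

/-- Hence at `o ≥ 2` a same-head presented label that has LEFT the regime (`¬ InPoly`) while well-prepared is NOT a position. -/
theorem Decoration.not_isPosT_of_presentation_of_not_inPoly (hadm : Admissible b δ) (hΘ0 : ∀ i, constantCoeff (Θ i) = 0)
    (hΘdet : IsUnit (FormalCoordChange.linMat Θ).det)
    (hΘE : ∀ l ∈ δ.E, ∃ (l' : Fin (2 + 1)) (u : MvPowerSeries (Fin (2 + 1)) k), constantCoeff u ≠ 0 ∧ Θ l = u * X l')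
    (hH : constantCoeff H ≠ 0) (hpres : subst Θ (δ.f * ∏ l ∈ δ.O, X l) = H * NCPoly.monicGerm d A) (hcd : δ.c = d) (ho : 2 ≤ δ.o)
    (hWP : PolyDescent.WellPrepared d A) (hn : ¬ PolyDescent.InPoly d A) : ¬ PolyDescent.IsPosT d A := fun hpos =>
  hn ⟨hWP, hpos, Decoration.newtonSet_nonempty_of_presentation hadm hΘ0 hΘdet hΘE hH hpres hcd ho⟩

/-- **THE SAME-HEAD EXIT, READ** (`k` algebraically closed): a same-head presented state whose (well-prepared) label has left the regime is in the apex
column. -/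
theorem Decoration.hCol_of_presentation_of_not_inPoly [IsAlgClosed k] (hadm : Admissible b δ) (hΘ0 : ∀ i, constantCoeff (Θ i) = 0)
    (hΘdet : IsUnit (FormalCoordChange.linMat Θ).det)
    (hΘE : ∀ l ∈ δ.E, ∃ (l' : Fin (2 + 1)) (u : MvPowerSeries (Fin (2 + 1)) k), constantCoeff u ≠ 0 ∧ Θ l = u * X l')
    (hH : constantCoeff H ≠ 0) (hd : 0 < d) (hpres : subst Θ (δ.f * ∏ l ∈ δ.O, X l) = H * NCPoly.monicGerm d A) (hcd : δ.c = d)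
    (ho : 2 ≤ δ.o) (hWP : PolyDescent.WellPrepared d A) (hn : ¬ PolyDescent.InPoly d A) : δ.HCol :=
  Decoration.hCol_of_presentation_of_not_isPosT hadm hΘ0 hΘdet hH hd hpres hcd hWP
    (Decoration.not_isPosT_of_presentation_of_not_inPoly hadm hΘ0 hΘdet hΘE hH hpres hcd ho hWP hn)

end Presented

end TameFourTupleDrop

end Summit.ResolutionOfSingularities.ResolutionOfSingularities.Theorems

end
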